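import Summits.BirchSwinnertonDyer.BirchSwinnertonDyer.Theorems.SignedLowerHalvesKobayashiMainConjectureSmallImageTeichSpanHeckeRelatorDefs
import Summits.BirchSwinnertonDyer.BirchSwinnertonDyer.Theorems.SignedLowerHalvesKobayashiMainConjectureSmallImageTeichSpanHeckePrelims
import HarnessLib

/-!
# Route `SignedLowerHalves`, crux `KobayashiMainConjectureSmallImage` (item stmt-BirchSwinnertonDyer-19002), line `birth_acns` v12,
# stub `stub_muOneSign_ns_ge5`: **the Hecke relators of a residually supersingular newform are killed by Manin's homomorphism**
# (cell `bsd-ssimc`, seat `bsd-line-slh-p3` gen 10, LEAD; THEOREMS ONLY; helper `--supports stmt-BirchSwinnertonDyer-19002`)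

Inputs for the dictionary «B⁰ modulo `G` + `IsManinKilled f p G` ⟹ unit orbit sum» (`…TeichSpanHeckeMod`, this seat):
* §1 `ratPlusSymbol_intCast_div_natCast_eq_of_intCast_eq` — `[x/M]⁺_f` only depends on `x mod M`.
* §2 `sum_heckeLImage_eq` — **the Manin value of a `T_ℓ`-image word** (`heckeLImages N p ℓ`, `ℓ ≠ p` prime, `ℓ ∤ N`): for any `μ` on
  `Γ₀(N)` agreeing with `γ ↦ [b(γ)/d(γ)]⁺ − [0]⁺` where `d(γ) ≠ 0`: `Σ_j μ(g_j) + μ(g_ℓ) = a_ℓ·[v/pⁿ]⁺ − (ℓ+1)·[0]⁺`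
  (MTT §I.4 (4.2) `a_ℓ[r]⁺ = Σ_j[(r+j)/ℓ]⁺ + [ℓr]⁺` at `r = v/pⁿ`).
* §3 `isManinKilled_heckePImages` (`p ∣ a_p`), `isManinKilled_heckeLImages` (`p ∣ a_ℓ`), **`isManinKilled_heckeRelators`**: for a rational
  newform `f` on `Γ₀(N)`, `p` odd, `p ∤ N`, `p ∣ a_p(f)`, with an Eisenstein multiple `n₀{∞,0} ∈ Λ_f` prime to `p` (integrality of `[·]⁺`
  at the `p`-power cusps), the whole relator set `heckeRelators f p` is killed mod `p` by Manin's homomorphism once `[0]⁺ ≡ 0`.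
HONEST SCOPE: bookkeeping on modular symbols; nothing about B⁰ / μ is asserted; BSD is not proved by any of this; no summit statement is
proved by this seat.
References: [MazurTateTeitelbaum1986Invent] §I.4 (4.2), §I.10 (10.1); [Manin1972] Prop. 1.4.
-/

-- D-0017: single-problem summit, the namespace repeats the problem name by design.
set_option linter.dupNamespace false
set_option autoImplicit false

noncomputable section

open scoped Classical MatrixGroups ModularForm
open CongruenceSubgroup Literature.NumberTheory.EllipticCurves.Rank1Residual

namespace Summit.BirchSwinnertonDyer.BirchSwinnertonDyer.Theorems.SmallImageTeichSpanHeckeModPrelims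

open Matrix Matrix.SpecialLinearGroup
  Literature.NumberTheory.EllipticCurves Literature.NumberTheory.EllipticCurves.ModularForms
  Summit.BirchSwinnertonDyer.BirchSwinnertonDyer.Theorems.CollapseThree
  Summit.BirchSwinnertonDyer.BirchSwinnertonDyer.Theorems.PrintX8VerticalStevens
  Summit.BirchSwinnertonDyer.BirchSwinnertonDyer.Cruxes.AnalyticMuZeroX9.TeichSpan
  Summit.BirchSwinnertonDyer.BirchSwinnertonDyer.Theorems.SmallImageTeichSpanHecke
  Summit.BirchSwinnertonDyer.BirchSwinnertonDyer.Theorems.SmallImageTeichSpanHeckePrelims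

/-! ### §1 `[x/M]⁺` only depends on `x mod M` -/

section Congr

variable {N : ℕ} [NeZero N] (f : CuspForm (Gamma0 N) 2)

/-- For integers `x ≡ y (mod M)`, `[x/M]⁺_f = [y/M]⁺_f` (`[r + k]⁺ = [r]⁺` for `k ∈ ℤ`). [cite: MazurTateTeitelbaum1986Invent, §I.4 (4.2)] -/
theorem ratPlusSymbol_intCast_div_natCast_eq_of_intCast_eq {M : ℕ} (hM : M ≠ 0) {x y : ℤ}
    (h : (x : ZMod M) = (y : ZMod M)) :
    ratPlusSymbol f ((x : ℚ) / (M : ℚ)) = ratPlusSymbol f ((y : ℚ) / (M : ℚ)) := by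
  rw [ZMod.intCast_eq_intCast_iff_dvd_sub] at h
  obtain ⟨k, hk⟩ := h
  have hMQ : (M : ℚ) ≠ 0 := Nat.cast_ne_zero.mpr hM
  have e : (x : ℚ) / (M : ℚ) = (y : ℚ) / (M : ℚ) + ((-k : ℤ) : ℚ) := by
    have hx : (x : ℤ) = y - M * k := by linarith
    rw [hx]; push_cast; field_simp; ring
  rw [e, ratPlusSymbol_add_intCast_eq]

end Congr

/-! ### §2 The Manin value of a `T_ℓ`-image word -/

section HeckeL

variable {N : ℕ} [NeZero N] {f : CuspForm (Gamma0 N) 2} {p : ℕ} [Fact p.Prime]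

/-- **The Manin value of a `T_ℓ`-image word** (`ℓ` prime, `ℓ ≠ p`, `ℓ ∤ N`, `a_ℓ(f) = aℓ ∈ ℤ`): with `v = (b mod pⁿ)`, for the word
`g_0 ⋯ g_{ℓ-1} · g_ℓ ∈ heckeLImages N p ℓ` at `(n, b)` and any `μ` with `μ(γ) = [b(γ)/d(γ)]⁺ − [0]⁺` (`d(γ) ≠ 0`):
`Σ_j μ(g_j) + μ(g_ℓ) = aℓ·[v/pⁿ]⁺ − (ℓ+1)·[0]⁺`.  Termwise: `[b(g_j)/d(g_j)]⁺ = [(v/pⁿ + j)/ℓ]⁺` (residue mod `ℓpⁿ`, resp. the reduced cusp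
`w/pⁿ`, `ℓ w = v + j pⁿ`, `w ≡ b(g_j) (mod pⁿ)`), `[b(g_ℓ)/pⁿ]⁺ = [ℓ·v/pⁿ]⁺`; then MTT (4.2) at `r = v/pⁿ`.
[cite: MazurTateTeitelbaum1986Invent, §I.4 (4.2)] [cite: Manin1972, Prop. 1.4] -/
theorem sum_heckeLImage_eq (hf : IsNewform0 f) {ℓ : ℕ} (hℓ : ℓ.Prime) (hℓp : ℓ ≠ p) (hℓN : ¬ ℓ ∣ N) {aℓ : ℤ}
    (haℓ : cuspCoeff f ℓ = aℓ) (hrat : ∀ r : ℚ, (ratPlusSymbol f r : ℝ) = normalizedPlusSymbol f r)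
    {μ : Gamma0 N → ℚ}
    (hμ : ∀ γ : Gamma0 N, dEntry γ ≠ 0 →
      μ γ = ratPlusSymbol f (((bEntry γ : ℤ) : ℚ) / ((dEntry γ : ℤ) : ℚ)) - ratPlusSymbol f 0)
    (n : ℕ) (b : ℤ) {g : Fin ℓ → Gamma0 N} {gℓ : Gamma0 N}
    (hg : ∀ j : Fin ℓ,
      (¬ ℓ ∣ (b : ZMod (p ^ n)).val + (j : ℕ) * p ^ n ∧ dEntry (g j) = (ℓ : ℤ) * (p : ℤ) ^ n ∧
          ((bEntry (g j) : ℤ) : ZMod (ℓ * p ^ n)) = (((b : ZMod (p ^ n)).val + (j : ℕ) * p ^ n : ℕ) : ZMod (ℓ * p ^ n))) ∨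
      (ℓ ∣ (b : ZMod (p ^ n)).val + (j : ℕ) * p ^ n ∧ dEntry (g j) = (p : ℤ) ^ n ∧
          (ℓ : ZMod (p ^ n)) * ((bEntry (g j) : ℤ) : ZMod (p ^ n)) = (b : ZMod (p ^ n))))
    (hdℓ : dEntry gℓ = (p : ℤ) ^ n) (hbℓ : ((bEntry gℓ : ℤ) : ZMod (p ^ n)) = (ℓ : ZMod (p ^ n)) * (b : ZMod (p ^ n))) :
    ∑ j : Fin ℓ, μ (g j) + μ gℓ =
      (aℓ : ℚ) * ratPlusSymbol f ((((b : ZMod (p ^ n)).val : ℚ)) / (p : ℚ) ^ n) - ((ℓ : ℚ) + 1) * ratPlusSymbol f 0 := by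
  classical
  have hp : p.Prime := Fact.out
  haveI : NeZero (p ^ n) := ⟨pow_ne_zero _ hp.ne_zero⟩
  haveI : Fact ℓ.Prime := ⟨hℓ⟩
  set v : ℕ := (b : ZMod (p ^ n)).val with hv
  have hpQ : (p : ℚ) ≠ 0 := Nat.cast_ne_zero.mpr hp.ne_zero
  have hℓQ : (ℓ : ℚ) ≠ 0 := Nat.cast_ne_zero.mpr hℓ.ne_zero
  have hpn0 : p ^ n ≠ 0 := pow_ne_zero _ hp.ne_zero
  have hvb : ((v : ℤ) : ZMod (p ^ n)) = (b : ZMod (p ^ n)) := by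
    rw [hv, Int.cast_natCast, ZMod.natCast_zmod_val]
  -- the Hecke relation at `r = v/pⁿ`
  have hH := intCast_mul_ratPlusSymbol ℓ hf hℓ hℓN haℓ hrat ((v : ℚ) / (p : ℚ) ^ n)
  -- termwise identification
  have hterm : ∀ j : Fin ℓ, μ (g j) = ratPlusSymbol f (((v : ℚ) / (p : ℚ) ^ n + ((j : ℕ) : ℚ)) / (ℓ : ℚ)) - ratPlusSymbol f 0 := by
    intro j
    rcases hg j with ⟨hndvd, hd, hbj⟩ | ⟨hdvd, hd, hbj⟩
    · -- the unreduced cusp `(v + j pⁿ)/(ℓ pⁿ)`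
      have hd0 : dEntry (g j) ≠ 0 := by
        rw [hd]; exact mul_ne_zero (by exact_mod_cast hℓ.ne_zero) (pow_ne_zero _ (by exact_mod_cast hp.ne_zero))
      rw [hμ (g j) hd0, hd]
      have e1 : (((ℓ : ℤ) * (p : ℤ) ^ n : ℤ) : ℚ) = ((ℓ * p ^ n : ℕ) : ℚ) := by push_cast; ring
      have e2 : ((v : ℚ) / (p : ℚ) ^ n + ((j : ℕ) : ℚ)) / (ℓ : ℚ) = (((v + (j : ℕ) * p ^ n : ℕ) : ℤ) : ℚ) / ((ℓ * p ^ n : ℕ) : ℚ) := by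
        push_cast; field_simp
      rw [e1, e2, ratPlusSymbol_intCast_div_natCast_eq_of_intCast_eq f (mul_ne_zero hℓ.ne_zero hpn0) (y := ((v + (j : ℕ) * p ^ n : ℕ) : ℤ))]
      rw [hbj, Int.cast_natCast]
    · -- the reduced cusp `w/pⁿ`, `ℓ w = v + j pⁿ`
      obtain ⟨w, hw⟩ := hdvd
      have hd0 : dEntry (g j) ≠ 0 := by rw [hd]; exact pow_ne_zero _ (by exact_mod_cast hp.ne_zero)
      rw [hμ (g j) hd0, hd]
      have e1 : (((p : ℤ) ^ n : ℤ) : ℚ) = ((p ^ n : ℕ) : ℚ) := by push_cast; ring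
      have e2 : ((v : ℚ) / (p : ℚ) ^ n + ((j : ℕ) : ℚ)) / (ℓ : ℚ) = ((w : ℤ) : ℚ) / ((p ^ n : ℕ) : ℚ) := by
        have hw' : ((v : ℚ) + ((j : ℕ) : ℚ) * (p : ℚ) ^ n) = (ℓ : ℚ) * (w : ℚ) := by exact_mod_cast hw
        push_cast; field_simp; linear_combination hw'
      rw [e1, e2, ratPlusSymbol_intCast_div_natCast_eq_of_intCast_eq f hpn0 (x := bEntry (g j)) (y := (w : ℤ))]
      -- `b(g_j) ≡ w (mod pⁿ)`: cancel the unit `ℓ`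
      have hℓu : IsUnit (ℓ : ZMod (p ^ n)) := by
        rw [ZMod.isUnit_prime_iff_not_dvd hℓ]
        intro h
        exact hℓp ((Nat.prime_dvd_prime_iff_eq hℓ hp).mp (hℓ.dvd_of_dvd_pow h))
      have h1 : (ℓ : ZMod (p ^ n)) * ((w : ℤ) : ZMod (p ^ n)) = (b : ZMod (p ^ n)) := by
        rw [← hvb]
        have hpn : ((p : ZMod (p ^ n))) ^ n = 0 := by rw [← Nat.cast_pow, ZMod.natCast_self]
        have : ((v + (j : ℕ) * p ^ n : ℕ) : ZMod (p ^ n)) = ((ℓ * w : ℕ) : ZMod (p ^ n)) := by rw [hw]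
        push_cast at this
        rw [hpn, mul_zero, add_zero] at this
        rw [Int.cast_natCast, Int.cast_natCast]
        exact this.symm
      exact hℓu.mul_left_cancel (hbj.trans h1.symm)
  have hlast : μ gℓ = ratPlusSymbol f ((ℓ : ℚ) * ((v : ℚ) / (p : ℚ) ^ n)) - ratPlusSymbol f 0 := by
    have hd0 : dEntry gℓ ≠ 0 := by rw [hdℓ]; exact pow_ne_zero _ (by exact_mod_cast hp.ne_zero)
    rw [hμ gℓ hd0, hdℓ]
    have e1 : (((p : ℤ) ^ n : ℤ) : ℚ) = ((p ^ n : ℕ) : ℚ) := by push_cast; ring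
    have e2 : (ℓ : ℚ) * ((v : ℚ) / (p : ℚ) ^ n) = (((ℓ * v : ℕ) : ℤ) : ℚ) / ((p ^ n : ℕ) : ℚ) := by push_cast; ring
    rw [e1, e2, ratPlusSymbol_intCast_div_natCast_eq_of_intCast_eq f hpn0 (y := ((ℓ * v : ℕ) : ℤ))]
    rw [hbℓ, ← hvb]; push_cast; ring
  rw [Finset.sum_congr rfl fun j _ ↦ hterm j, Finset.sum_sub_distrib, Finset.sum_const, Finset.card_univ, Fintype.card_fin,
    nsmul_eq_mul, hlast]
  linear_combination -hH

end HeckeL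

/-! ### §3 The Hecke relators are killed by Manin's homomorphism -/

section Killed

variable {N : ℕ} [NeZero N] {f : CuspForm (Gamma0 N) 2} {p : ℕ} [Fact p.Prime]

/-- Integrality at the `p`-power cusps from an Eisenstein multiple prime to `p` (as in the f3-mu dictionary).
[cite: MazurTateTeitelbaum1986Invent, §I.10 (10.1)] -/
theorem norm_ratPlusSymbol_natCast_div_pow_le_one (hp2 : p ≠ 2) (hpN : ¬ p ∣ N) {n₀ : ℤ} (hpn₀ : ¬ (p : ℤ) ∣ n₀)
    (h0 : (n₀ : ℂ) * modularSymbol f 0 ∈ periodLattice f) (k n : ℕ) :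
    ‖((ratPlusSymbol f ((k : ℚ) / (p : ℚ) ^ n) : ℚ) : ℚ_[p])‖ ≤ 1 := by
  have hp : p.Prime := Fact.out
  have hcop : Nat.Coprime (p ^ n) N := Nat.Coprime.pow_left n ((Nat.Prime.coprime_iff_not_dvd hp).mpr hpN)
  have hx := coprime_den_of_coprime (N := N) hcop (k : ℤ)
  rw [Int.cast_natCast, Nat.cast_pow] at hx
  exact norm_ratPlusSymbol_le_one f hp2 hpn₀ h0 hx

omit [NeZero N] in
/-- A list version of additivity: `m(∏ l) = Σ m(l)`. [folklore] -/
theorem apply_list_prod_eq_sum {m : Gamma0 N → ℤ} (h1 : m 1 = 0) (hmul : ∀ x y : Gamma0 N, m (x * y) = m x + m y)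
    (l : List (Gamma0 N)) : m l.prod = (l.map m).sum := by
  induction l with
  | nil => simp [h1]
  | cons g l ih => rw [List.prod_cons, hmul, ih, List.map_cons, List.sum_cons]

omit [NeZero N] in
/-- `(Σ l)/2 = Σ (·/2)` over a list of integers cast to `ℚ`. [folklore] -/
theorem intCast_list_sum_div_two (m : Gamma0 N → ℤ) (l : List (Gamma0 N)) :
    (((l.map m).sum : ℤ) : ℚ) / 2 = (l.map fun g ↦ (m g : ℚ) / 2).sum := by
  induction l with
  | nil => simp
  | cons g l ih => simp only [List.map_cons, List.sum_cons, Int.cast_add, add_div, ih]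

/-- **The `T_p`-images are killed** (`p` odd, `p ∤ N`, `p ∣ a_p(f)`, Eisenstein multiple): `IsManinKilled f p (heckePImages N p)`.
(`m(R)/2 = a_p[v/p^{n+1}]⁺ − (p+1)[0]⁺`, `sum_heckePImage_eq`.) [cite: MazurTateTeitelbaum1986Invent, §I.4 (4.2)] [cite: Manin1972, Prop. 1.4] -/
theorem isManinKilled_heckePImages (hf : IsNewform0 f) (hQ : coeffField f = ⊥) (hp2 : p ≠ 2) (hpN : ¬ p ∣ N) {ap : ℤ}
    (hap : cuspCoeff f p = ap) (hpap : (p : ℤ) ∣ ap) {n₀ : ℤ} (hpn₀ : ¬ (p : ℤ) ∣ n₀)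
    (h0 : (n₀ : ℂ) * modularSymbol f 0 ∈ periodLattice f) : IsManinKilled f p (heckePImages N p) := by
  intro m h1 hmul hcusp hzero R hR
  obtain ⟨n, b, l, δ, hlen, hl, hnd, hdδ, hbδ, rfl⟩ := hR
  have hp : p.Prime := Fact.out
  haveI : NeZero (p ^ (n + 1)) := ⟨pow_ne_zero _ hp.ne_zero⟩
  have hrat : ∀ r : ℚ, (ratPlusSymbol f r : ℝ) = normalizedPlusSymbol f r := fun r ↦ ratCast_ratPlusSymbol_holds hf hQ r
  have hval := sum_heckePImage_eq hf hpN hap hrat (μ := fun γ ↦ (m γ : ℚ) / 2) (fun γ hd ↦ (hcusp γ hd).symm)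
    n b hlen hl hnd hdδ hbδ
  have hsum2 : ((((l.map m).sum + m δ : ℤ) : ℚ) / 2 : ℚ) =
      (ap : ℚ) * ratPlusSymbol f ((((b : ZMod (p ^ (n + 1))).val : ℚ)) / (p : ℚ) ^ (n + 1)) -
        ((p : ℚ) + 1) * ratPlusSymbol f 0 := by
    rw [Int.cast_add, add_div, intCast_list_sum_div_two m l]
    exact hval
  have hapn : ‖((ap : ℚ) : ℚ_[p])‖ < 1 := by
    have h : ‖((ap : ℤ) : ℚ_[p])‖ < 1 := Padic.norm_intCast_lt_one_iff.mpr hpap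
    exact_mod_cast h
  rw [hmul, apply_list_prod_eq_sum h1 hmul]
  apply dvd_of_norm_div_two_lt_one hp2
  rw [hsum2]
  push_cast
  refine norm_sub_lt_one ?_ ?_
  · rw [mul_comm]
    exact padic_norm_mul_lt_one (norm_ratPlusSymbol_natCast_div_pow_le_one hp2 hpN hpn₀ h0 _ (n + 1)) hapn
  · have hp1 : ‖(p : ℚ_[p]) + 1‖ ≤ 1 :=
      (Padic.nonarchimedean _ _).trans (max_le (le_of_lt Padic.norm_p_lt_one) (by rw [norm_one]))
    exact padic_norm_mul_lt_one hp1 hzero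

/-- **The `T_ℓ`-images are killed** (`ℓ ≠ p` prime, `ℓ ∤ N`, `p ∣ a_ℓ(f) ∈ ℤ`; `p` odd, `p ∤ N`, Eisenstein multiple):
`IsManinKilled f p (heckeLImages N p ℓ)`.  (`m(R)/2 = a_ℓ[v/pⁿ]⁺ − (ℓ+1)[0]⁺`, `sum_heckeLImage_eq`.)
[cite: MazurTateTeitelbaum1986Invent, §I.4 (4.2)] [cite: Manin1972, Prop. 1.4] -/
theorem isManinKilled_heckeLImages (hf : IsNewform0 f) (hQ : coeffField f = ⊥) (hp2 : p ≠ 2) (hpN : ¬ p ∣ N) {ℓ : ℕ}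
    (hℓ : ℓ.Prime) (hℓp : ℓ ≠ p) (hℓN : ¬ ℓ ∣ N) {aℓ : ℤ} (haℓ : cuspCoeff f ℓ = aℓ) (hpaℓ : (p : ℤ) ∣ aℓ) {n₀ : ℤ}
    (hpn₀ : ¬ (p : ℤ) ∣ n₀) (h0 : (n₀ : ℂ) * modularSymbol f 0 ∈ periodLattice f) : IsManinKilled f p (heckeLImages N p ℓ) := by
  intro m h1 hmul hcusp hzero R hR
  obtain ⟨n, b, g, gℓ, hg, hdℓ, hbℓ, rfl⟩ := hR
  have hp : p.Prime := Fact.out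
  haveI : NeZero (p ^ n) := ⟨pow_ne_zero _ hp.ne_zero⟩
  have hrat : ∀ r : ℚ, (ratPlusSymbol f r : ℝ) = normalizedPlusSymbol f r := fun r ↦ ratCast_ratPlusSymbol_holds hf hQ r
  have hval := sum_heckeLImage_eq hf hℓ hℓp hℓN haℓ hrat (μ := fun γ ↦ (m γ : ℚ) / 2) (fun γ hd ↦ (hcusp γ hd).symm)
    n b hg hdℓ hbℓ
  have hsum2 : (((((List.ofFn g).map m).sum + m gℓ : ℤ) : ℚ) / 2 : ℚ) =
      (aℓ : ℚ) * ratPlusSymbol f ((((b : ZMod (p ^ n)).val : ℚ)) / (p : ℚ) ^ n) - ((ℓ : ℚ) + 1) * ratPlusSymbol f 0 := by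
    rw [Int.cast_add, add_div, intCast_list_sum_div_two m, List.map_ofFn, List.sum_ofFn]
    exact hval
  have haℓn : ‖((aℓ : ℚ) : ℚ_[p])‖ < 1 := by
    have h : ‖((aℓ : ℤ) : ℚ_[p])‖ < 1 := Padic.norm_intCast_lt_one_iff.mpr hpaℓ
    exact_mod_cast h
  rw [hmul, apply_list_prod_eq_sum h1 hmul]
  apply dvd_of_norm_div_two_lt_one hp2
  rw [hsum2]
  push_cast
  refine norm_sub_lt_one ?_ ?_
  · rw [mul_comm]
    exact padic_norm_mul_lt_one (norm_ratPlusSymbol_natCast_div_pow_le_one hp2 hpN hpn₀ h0 _ n) haℓn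
  · have hℓ1 : ‖(ℓ : ℚ_[p]) + 1‖ ≤ 1 := by
      have h : ‖((ℓ + 1 : ℤ) : ℚ_[p])‖ ≤ 1 := Padic.norm_int_le_one _
      push_cast at h
      exact h
    exact padic_norm_mul_lt_one hℓ1 hzero

/-- **All Hecke relators of `f` at `p` are killed**: `IsManinKilled f p (heckeRelators f p)` for a rational newform `f` on `Γ₀(N)`,
`p` odd, `p ∤ N`, `p ∣ a_p(f)`, with an Eisenstein multiple `n₀{∞,0} ∈ Λ_f` prime to `p` (the `T_ℓ`-part carries its own
divisibility `p ∣ a_ℓ` in the definition of `heckeRelators`). [cite: MazurTateTeitelbaum1986Invent, §I.4 (4.2)] [cite: Manin1972, Prop. 1.4] -/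
theorem isManinKilled_heckeRelators (hf : IsNewform0 f) (hQ : coeffField f = ⊥) (hp2 : p ≠ 2) (hpN : ¬ p ∣ N) {ap : ℤ}
    (hap : cuspCoeff f p = ap) (hpap : (p : ℤ) ∣ ap) {n₀ : ℤ} (hpn₀ : ¬ (p : ℤ) ∣ n₀)
    (h0 : (n₀ : ℂ) * modularSymbol f 0 ∈ periodLattice f) : IsManinKilled f p (heckeRelators f p) := by
  refine (isManinKilled_heckePImages hf hQ hp2 hpN hap hpap hpn₀ h0).union (IsManinKilled.biUnion ?_)
  rintro ℓ ⟨hℓ, hℓp, hℓN, a, ha, hpa⟩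
  exact isManinKilled_heckeLImages hf hQ hp2 hpN hℓ hℓp hℓN ha hpa hpn₀ h0

end Killed

end Summit.BirchSwinnertonDyer.BirchSwinnertonDyer.Theorems.SmallImageTeichSpanHeckeModPrelims

end
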